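import Literature.MathematicalPhysics.QuantumFieldTheory.Balaban1983to89.B9Thm31SiteGpWeightedReg335Y

/-!
# `Balaban1983to89.B9Thm31SiteGpKernelTorusDecayReg335Y` — T. Bałaban, *Propagators for lattice gauge theories in a background field*, Commun. Math. Phys. **99**
# (1985) 389–434 [Balaban1985BackgroundPropagators] Thm 3.1 (3.42)∕(3.46) pp. 397–398, by S. Agmon's method [Agmon1982]: ★★★ **AN EXPLICIT ADMISSIBLE AGMON
# WEIGHT AND THE HYPOTHESIS-FREE KERNEL DECAY OF def-Y's `G′(U)` ON THE (3.35) CLASS** — `ρ_y(z) := (L^k)⁻¹·|z − y|_T` (torus sup-distance in units of the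
# coarsest block) is admissible, hence `HS((G′(U)(δ_y ⊗ E))(x)) ≤ 256·(L^{lev x})²(L^{lev y})²·e^{−2δ₀|x−y|_T∕L^k}·HS(E)`, `δ₀ = 1∕(4(d+2))`, with NO hypothesis on
# the weight left (file 15 of the site-coercivity set of width seat `pub-ymgap-dag-n06-w1`; the A6 «non-vacuity with teeth» of files 6–10)

statement-level skeleton of published theorems with citation tags; proofs where landed; nothing here is a claim about the Yang–Mills mass gap

THE PRINT (p. 397).  (3.42): *«|(G′(U)λ)(x)| … ≤ B₀(Lʲη)² e^{−δ₀d(y,y′)}|λ| for x ∈ Δ(y), y ∈ Λ_j, supp λ ⊂ Δ(y′)»*; p. 397: *«we will use the weighted distance d(y,y′)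
defined by (2.36) in [4]»*.  Files 6–10 proved the `L²` entries of Thm 3.1 for ANY weight exponent `ρ` with the two Lipschitz properties (bond steps
`≤ (L^{lev})⁻¹`, block oscillation `≤ d+1`).  THIS FILE exhibits the simplest such `ρ` on every member — the torus sup-distance to the source site divided by
the coarsest scale `L^k` — and so makes the kernel bound of file 10 hypothesis-free: exponential decay at rate `δ₀∕L^k` per lattice step.  (Print's sharper
multi-scale rate `e^{−δ₀d(y,y′)}` needs the site-level refinement of `d` adapted to `{Ω_j}`; that comparison is not typed here and `ρ` stays available as a parameter
in files 6–10.)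

WHAT IS PROVED (sorry-free; 0 `def`; nothing of [B9] asserted beyond what is proved).
* §1 (private `abs_sub_le_pred_of_blk_eq`: same block of side `b` ⇒ `|z_ν − w_ν| ≤ b − 1`), `torusSupNorm_sub_le_of_blkOf_eq` (`|z − w|_T ≤ L^{lev} − 1` on a block of `𝔅`),
  `abs_torusSupNorm_shift_sub_le` (`||σ_μz − y|_T − |z − y|_T| ≤ 1`).
* §2 ★★ `torusAgmon_bond`, `torusAgmon_bond'`, `torusAgmon_block` — `ρ_y = (L^k)⁻¹|· − y|_T` meets the hypotheses of files 7∕10 (bond steps `≤ (L^k)⁻¹ ≤ (L^{lev})⁻¹`,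
  block oscillation `< 1 ≤ d+1`), `torusAgmon_self` (`ρ_y(y) = 0`).
* §3 ★★★ **`hs_GpY_deltaY_le_torus`**: `G ≤ U(N)`, `N ≥ 1`, `0 ≤ c·M·α₀`, `c·M·α₀·(d+1) ≤ 1∕16`, `U ∈ Reg335 c α₀`, sites `x, y`, fibre value `E`:
  `HS((G′(U)(δ_y ⊗ E))(x)) ≤ 256·((L^{lev x})²(L^{lev y})²∕(e^{δ₀(L^k)⁻¹|x−y|_T})²)·HS(E)`.
MODEL ∕ DECLARED READINGS.  As files 6–10; `|·|_T = torusSupNorm` of NODE 00's torus box (period vector `(toKT i).NB`), `L^k = (ℓ+1)^{i.k}`.  NON-VACUITY (A6): the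
statement has no weight hypothesis; the class is inhabited (`reg335_one`, pure gauges).  HONEST SCOPE.  A decay estimate for one finite lattice operator at the
coarsest scale only; NOT a node discharge, NOT summit progress; count-neutral; nothing continuum ∕ OS ∕ mass gap ∕ Clay.  NEW file importing file 10 only.
-/

noncomputable section

namespace Literature.MathematicalPhysics.QuantumFieldTheory.Balaban1983to89.B9Thm31SiteGpKernelTorusDecayReg335Y

open Literature.MathematicalPhysics.QuantumFieldTheory.Balaban1983to89
open Node00 B6KLevelCensusIndexV1 B6Geom246MultiLevelBox B6MultiLevelBoxOperator B6MultiLevelTorusOperator B6GlobalChartV1 B9BackgroundsKLevelV1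
  B9Eq39Adjoint B9Thm311ReadingCoords B9Thm311DeltaPrimePos B9Ineq369CurvatureSmallAtLettersY B9Thm31SiteCoerciveGaugeBlockY
  B9Thm31SiteCoerciveReg335Y B9Thm31SiteGpBoundsReg335Y B9Thm31SitePolarisedFormY B9Thm31SiteConjugatedFormY B9Thm31SiteGpDecayReg335Y
  B9Thm31SiteAgmonWeightY B9Thm31SiteGpWeightedReg335Y
open Literature.MathematicalPhysics.QuantumFieldTheory.Balaban1983to89.B4TorusKernel.MultiPeriod (torusSupNorm torusSupNorm_nonneg torusSupNorm_le_supNorm)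
open Literature.MathematicalPhysics.QuantumFieldTheory.Balaban1983to89.B4ContourShift (supNorm abs_le_supNorm)
open Literature.MathematicalPhysics.QuantumFieldTheory.Balaban1983to89.B4Reflection242 (blk)
open Literature.MathematicalPhysics.QuantumFieldTheory.Balaban1983to89.B6MemberOfCubeV1 (torusSupNorm_sub_le)
open Literature.MathematicalPhysics.QuantumFieldTheory.Balaban1983to89.B6Cov2110WeightV1 (torusSupNorm_zero)
open Literature.MathematicalPhysics.QuantumFieldTheory.Balaban1983to89.B6CubeCoeffSizesV1 (torusSupNorm_tshift_unitVec_le)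
open scoped Matrix Matrix.Norms.L2Operator

/-! ## §1 Sites of one block are close; one lattice step moves the torus distance by at most one -/

section Geometry

variable {d : ℕ}

/-- same block of side `b ≥ 1` ⇒ coordinates differ by at most `b − 1`: `blk b z = blk b w ⇒ |z_ν − w_ν| ≤ b − 1`. [folklore] -/
private theorem abs_sub_le_pred_of_blk_eq {b : ℕ} (hb : 1 ≤ b) {z w : Fin (d + 1) → ℤ} (h : blk b z = blk b w) (ν : Fin (d + 1)) : |z ν - w ν| ≤ (b : ℤ) - 1 := by
  have hb' : (0 : ℤ) < b := by exact_mod_cast hb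
  have hq : z ν / (b : ℤ) = w ν / (b : ℤ) := congrFun h ν
  have hz : z ν % (b : ℤ) = z ν - (b : ℤ) * (z ν / (b : ℤ)) := Int.emod_def _ _
  have hw : w ν % (b : ℤ) = w ν - (b : ℤ) * (w ν / (b : ℤ)) := Int.emod_def _ _
  have hz0 := Int.emod_nonneg (z ν) hb'.ne'
  have hw0 := Int.emod_nonneg (w ν) hb'.ne'
  have hz1 := Int.emod_lt_of_pos (z ν) hb'
  have hw1 := Int.emod_lt_of_pos (w ν) hb'
  rw [abs_le]
  constructor <;> nlinarith

variable {ℓ : ℕ} {hd : 1 ≤ d + 1} {hL : Odd (ℓ + 1) ∧ 1 < ℓ + 1} {b₀ b₁ : ℝ}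
variable (i : KIdx d ℓ hd hL b₀ b₁)

/-- the period vector of NODE 00's torus box has entries `≥ 1`. [cite: Balaban1984PropagatorsII, (2.1) p.224, bookkeeping] -/
theorem one_le_NB (z : SiteY i) : ∀ ν, 1 ≤ (toKT i).NB ν := fun ν => one_le_of_mem z.2 ν

/-- TWO SITES OF ONE BLOCK OF `𝔅` ARE WITHIN `L^{lev} − 1` IN TORUS SUP-DISTANCE. [cite: Balaban1984PropagatorsII, (2.3)–(2.4) p.224, bookkeeping] -/
theorem torusSupNorm_sub_le_of_blkOf_eq {z w : SiteY i} (h : blkOf i.D.toDomains w = blkOf i.D.toDomains z) :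
    torusSupNorm (toKT i).NB (z.1 - w.1) ≤ (((ℓ + 1) ^ (blkOf i.D.toDomains z).1.1 : ℕ) : ℝ) - 1 := by
  have hN1 := one_le_NB i z
  set s := blkOf i.D.toDomains z with hs
  have hzb : blk ((ℓ + 1) ^ s.1.1) z.1 = s.1.2 := (blkOf_eq_iff_blk (D := i.D.toDomains)).1 hs.symm
  have hwb : blk ((ℓ + 1) ^ s.1.1) w.1 = s.1.2 := (blkOf_eq_iff_blk (D := i.D.toDomains)).1 h
  have hb : 1 ≤ (ℓ + 1) ^ s.1.1 := Nat.one_le_pow _ _ (Nat.succ_pos ℓ)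
  have hcoord : ∀ ν, |(z.1 - w.1) ν| ≤ (((ℓ + 1) ^ s.1.1 : ℕ) : ℤ) - 1 := fun ν => by
    rw [Pi.sub_apply]
    exact abs_sub_le_pred_of_blk_eq hb (hzb.trans hwb.symm) ν
  refine (torusSupNorm_le_supNorm hN1 _).trans ?_
  refine Finset.sup'_le _ _ fun ν _ => ?_
  have h1 := hcoord ν
  have h2 : (((|(z.1 - w.1) ν| : ℤ)) : ℝ) ≤ (((((ℓ + 1) ^ s.1.1 : ℕ) : ℤ) - 1 : ℤ) : ℝ) := by exact_mod_cast h1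
  refine h2.trans (le_of_eq ?_)
  push_cast; ring

/-- ONE LATTICE STEP MOVES THE TORUS DISTANCE TO `y` BY AT MOST ONE: `| |σ_μz − y|_T − |z − y|_T | ≤ 1`. [cite: Balaban1984PropagatorsII, (2.46) p.231, bookkeeping] -/
theorem abs_torusSupNorm_shift_sub_le (μ : Fin (d + 1)) (z y : SiteY i) :
    |torusSupNorm (toKT i).NB ((shiftY i μ z).1 - y.1) - torusSupNorm (toKT i).NB (z.1 - y.1)| ≤ 1 := by
  have hN1 := one_le_NB i z
  have hstep : torusSupNorm (toKT i).NB ((shiftY i μ z).1 - z.1) ≤ 1 := by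
    show torusSupNorm (toKT i).NB ((tshift (toKT i).NB (unitVec μ) z).1 - z.1) ≤ 1
    exact torusSupNorm_tshift_unitVec_le hN1 μ z
  have hstep' : torusSupNorm (toKT i).NB (z.1 - (shiftY i μ z).1) ≤ 1 := by
    rw [show z.1 - (shiftY i μ z).1 = -((shiftY i μ z).1 - z.1) by abel, B6Geom246MultiLevelTorus.torusSupNorm_neg hN1]
    exact hstep
  have h1 := torusSupNorm_sub_le hN1 (shiftY i μ z).1 z.1 y.1
  have h2 := torusSupNorm_sub_le hN1 z.1 (shiftY i μ z).1 y.1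
  rw [abs_le]
  constructor <;> linarith

end Geometry

/-! ## §2 The torus Agmon exponent `ρ_y = (L^k)⁻¹·|· − y|_T` is admissible -/

section Weight

variable {d ℓ : ℕ} {hd : 1 ≤ d + 1} {hL : Odd (ℓ + 1) ∧ 1 < ℓ + 1} {b₀ b₁ : ℝ}
variable (i : KIdx d ℓ hd hL b₀ b₁)

/-- ★★ BOND STEPS (source end): `|ρ_y(z+e_μ) − ρ_y(z)| ≤ (L^k)⁻¹ ≤ (L^{lev z})⁻¹`. [cite: Agmon1982, Ch.1; Balaban1984PropagatorsII, (2.1)–(2.4) p.224] -/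
theorem torusAgmon_bond (y : SiteY i) (μ : Fin (d + 1)) (z : SiteY i) :
    |((((ℓ + 1) ^ i.k : ℕ) : ℝ))⁻¹ * torusSupNorm (toKT i).NB ((shiftY i μ z).1 - y.1) - ((((ℓ + 1) ^ i.k : ℕ) : ℝ))⁻¹ * torusSupNorm (toKT i).NB (z.1 - y.1)|
      ≤ ((((ℓ + 1) ^ (blkOf i.D.toDomains z).1.1 : ℕ) : ℝ))⁻¹ := by
  have hk : (0 : ℝ) < (((ℓ + 1) ^ i.k : ℕ) : ℝ) := by positivity
  rw [← mul_sub, abs_mul, abs_of_pos (inv_pos.2 hk)]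
  have h := abs_torusSupNorm_shift_sub_le i μ z y
  have hpow : (((ℓ + 1) ^ (blkOf i.D.toDomains z).1.1 : ℕ) : ℝ) ≤ (((ℓ + 1) ^ i.k : ℕ) : ℝ) := by
    exact_mod_cast Nat.pow_le_pow_right (Nat.succ_pos ℓ) (B9GeoNormsKLevelV1.blkOf_level_le i z)
  calc ((((ℓ + 1) ^ i.k : ℕ) : ℝ))⁻¹ * |torusSupNorm (toKT i).NB ((shiftY i μ z).1 - y.1) - torusSupNorm (toKT i).NB (z.1 - y.1)|
      ≤ ((((ℓ + 1) ^ i.k : ℕ) : ℝ))⁻¹ * 1 := mul_le_mul_of_nonneg_left h (inv_nonneg.2 hk.le)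
    _ ≤ ((((ℓ + 1) ^ (blkOf i.D.toDomains z).1.1 : ℕ) : ℝ))⁻¹ := by rw [mul_one]; exact inv_anti₀ (by positivity) hpow

/-- ★★ BOND STEPS (target end): the same with the level of `z+e_μ`. [cite: Agmon1982, Ch.1; Balaban1984PropagatorsII, (2.1)–(2.4) p.224] -/
theorem torusAgmon_bond' (y : SiteY i) (μ : Fin (d + 1)) (z : SiteY i) :
    |((((ℓ + 1) ^ i.k : ℕ) : ℝ))⁻¹ * torusSupNorm (toKT i).NB ((shiftY i μ z).1 - y.1) - ((((ℓ + 1) ^ i.k : ℕ) : ℝ))⁻¹ * torusSupNorm (toKT i).NB (z.1 - y.1)|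
      ≤ ((((ℓ + 1) ^ (blkOf i.D.toDomains (shiftY i μ z)).1.1 : ℕ) : ℝ))⁻¹ := by
  have hk : (0 : ℝ) < (((ℓ + 1) ^ i.k : ℕ) : ℝ) := by positivity
  rw [← mul_sub, abs_mul, abs_of_pos (inv_pos.2 hk)]
  have h := abs_torusSupNorm_shift_sub_le i μ z y
  have hpow : (((ℓ + 1) ^ (blkOf i.D.toDomains (shiftY i μ z)).1.1 : ℕ) : ℝ) ≤ (((ℓ + 1) ^ i.k : ℕ) : ℝ) := by
    exact_mod_cast Nat.pow_le_pow_right (Nat.succ_pos ℓ) (B9GeoNormsKLevelV1.blkOf_level_le i (shiftY i μ z))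
  calc ((((ℓ + 1) ^ i.k : ℕ) : ℝ))⁻¹ * |torusSupNorm (toKT i).NB ((shiftY i μ z).1 - y.1) - torusSupNorm (toKT i).NB (z.1 - y.1)|
      ≤ ((((ℓ + 1) ^ i.k : ℕ) : ℝ))⁻¹ * 1 := mul_le_mul_of_nonneg_left h (inv_nonneg.2 hk.le)
    _ ≤ ((((ℓ + 1) ^ (blkOf i.D.toDomains (shiftY i μ z)).1.1 : ℕ) : ℝ))⁻¹ := by rw [mul_one]; exact inv_anti₀ (by positivity) hpow

/-- ★★ BLOCK OSCILLATION: on one block of `𝔅`, `|ρ_y(z) − ρ_y(w)| ≤ (L^k)⁻¹(L^{lev} − 1) < 1 ≤ d+1`. [cite: Agmon1982, Ch.1; Balaban1984PropagatorsII, (2.3)–(2.4) p.224] -/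
theorem torusAgmon_block (y z w : SiteY i) (h : blkOf i.D.toDomains w = blkOf i.D.toDomains z) :
    |((((ℓ + 1) ^ i.k : ℕ) : ℝ))⁻¹ * torusSupNorm (toKT i).NB (z.1 - y.1) - ((((ℓ + 1) ^ i.k : ℕ) : ℝ))⁻¹ * torusSupNorm (toKT i).NB (w.1 - y.1)| ≤ (d : ℝ) + 1 := by
  have hN1 := one_le_NB i z
  have hk : (0 : ℝ) < (((ℓ + 1) ^ i.k : ℕ) : ℝ) := by positivity
  rw [← mul_sub, abs_mul, abs_of_pos (inv_pos.2 hk)]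
  -- `| |z−y|_T − |w−y|_T | ≤ |z − w|_T ≤ L^{lev} − 1 < L^k`
  have h1 := torusSupNorm_sub_le hN1 z.1 w.1 y.1
  have h2 := torusSupNorm_sub_le hN1 w.1 z.1 y.1
  have hzw := torusSupNorm_sub_le_of_blkOf_eq i h
  have hwz : torusSupNorm (toKT i).NB (w.1 - z.1) ≤ (((ℓ + 1) ^ (blkOf i.D.toDomains z).1.1 : ℕ) : ℝ) - 1 := by
    rw [show w.1 - z.1 = -(z.1 - w.1) by abel, B6Geom246MultiLevelTorus.torusSupNorm_neg hN1]; exact hzw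
  have habs : |torusSupNorm (toKT i).NB (z.1 - y.1) - torusSupNorm (toKT i).NB (w.1 - y.1)| ≤ (((ℓ + 1) ^ (blkOf i.D.toDomains z).1.1 : ℕ) : ℝ) - 1 := by
    rw [abs_le]; constructor <;> linarith
  have hpow : (((ℓ + 1) ^ (blkOf i.D.toDomains z).1.1 : ℕ) : ℝ) ≤ (((ℓ + 1) ^ i.k : ℕ) : ℝ) := by
    exact_mod_cast Nat.pow_le_pow_right (Nat.succ_pos ℓ) (B9GeoNormsKLevelV1.blkOf_level_le i z)
  have hd0 : (0 : ℝ) ≤ d := Nat.cast_nonneg d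
  calc ((((ℓ + 1) ^ i.k : ℕ) : ℝ))⁻¹ * |torusSupNorm (toKT i).NB (z.1 - y.1) - torusSupNorm (toKT i).NB (w.1 - y.1)|
      ≤ ((((ℓ + 1) ^ i.k : ℕ) : ℝ))⁻¹ * (((ℓ + 1) ^ i.k : ℕ) : ℝ) := mul_le_mul_of_nonneg_left (habs.trans (by linarith)) (inv_nonneg.2 hk.le)
    _ = 1 := inv_mul_cancel₀ hk.ne'
    _ ≤ (d : ℝ) + 1 := by linarith

/-- `ρ_y(y) = 0`. [cite: Agmon1982, Ch.1, bookkeeping] -/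
theorem torusAgmon_self (y : SiteY i) : ((((ℓ + 1) ^ i.k : ℕ) : ℝ))⁻¹ * torusSupNorm (toKT i).NB (y.1 - y.1) = 0 := by
  rw [sub_self, torusSupNorm_zero, mul_zero]

end Weight

/-! ## §3 The hypothesis-free kernel decay -/

section Main

variable {d ℓ : ℕ} {hd : 1 ≤ d + 1} {hL : Odd (ℓ + 1) ∧ 1 < ℓ + 1} {b₀ b₁ : ℝ}
variable (i : KIdx d ℓ hd hL b₀ b₁) {N : ℕ} {G : Subgroup (Matrix (Fin N) (Fin N) ℂ)ˣ}

/-- ★★★ **THE KERNEL OF `G′(U)` DECAYS EXPONENTIALLY IN THE TORUS DISTANCE, UNIFORMLY ON THE CLASS (3.35)** — no weight hypothesis: `G ≤ U(N)`, `N ≥ 1`,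
`0 ≤ c·M·α₀`, `c·M·α₀·(d+1) ≤ 1∕16`, `U ∈ (bg9K (M_N ℂ) G i).Reg335 c α₀`, sites `x, y`, fibre value `E`:
`HS((G′(U)(δ_y ⊗ E))(x)) ≤ 256·((L^{lev x})²(L^{lev y})²∕(e^{δ₀(L^k)⁻¹|x−y|_T})²)·HS(E)`, `δ₀ = 1∕(4(d+2))` — i.e. `‖G′(U; x, y)‖_{HS→HS} ≤ 16·L^{lev x + lev y}·e^{−δ₀|x−y|_T∕L^k}`.
[cite: Balaban1985BackgroundPropagators, Thm 3.1 (3.42) p.397, (3.46) p.398, (3.35) p.396; Agmon1982, Ch.1, Thm 1.5] -/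
theorem hs_GpY_deltaY_le_torus [Nonempty (Fin N)] (hG : G ≤ B7Prop2Explicit.unitaryUnits (Matrix (Fin N) (Fin N) ℂ))
    {U : CfgY (Matrix (Fin N) (Fin N) ℂ) i} {c α₀ : ℝ} (hC0 : 0 ≤ c * (kGeo i).M * α₀) (hC1 : c * (kGeo i).M * α₀ * ((d : ℝ) + 1) ≤ 1 / 16)
    (hreg : (bg9K (Matrix (Fin N) (Fin N) ℂ) G i).Reg335 c α₀ U) (x y : SiteY i) (E : Matrix (Fin N) (Fin N) ℂ) :
    ∑ a, ∑ b, ‖GpY i (parSymY i) U (deltaY y E) x a b‖ ^ 2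
      ≤ 256 * (((((ℓ + 1) ^ (blkOf i.D.toDomains x).1.1 : ℕ) : ℝ)) ^ 2 * ((((ℓ + 1) ^ (blkOf i.D.toDomains y).1.1 : ℕ) : ℝ)) ^ 2
          / Real.exp ((1 / (4 * ((d : ℝ) + 2))) * (((((ℓ + 1) ^ i.k : ℕ) : ℝ))⁻¹ * torusSupNorm (toKT i).NB (x.1 - y.1))) ^ 2) * ∑ a, ∑ b, ‖E a b‖ ^ 2 :=
  hs_GpY_deltaY_le_exp_canonical i hG hC0 hC1 hreg (ρ := fun z => ((((ℓ + 1) ^ i.k : ℕ) : ℝ))⁻¹ * torusSupNorm (toKT i).NB (z.1 - y.1))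
    (fun μ z => torusAgmon_bond i y μ z) (fun μ z => torusAgmon_bond' i y μ z) (fun z w h => torusAgmon_block i y z w h) x y (torusAgmon_self i y) le_rfl E

end Main

end Literature.MathematicalPhysics.QuantumFieldTheory.Balaban1983to89.B9Thm31SiteGpKernelTorusDecayReg335Y
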